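import Literature.NumberTheory.LFunctions.ClassGroupExplicitFormula
import Literature.NumberTheory.LFunctions.DedekindZeta1LogFreeLemmaB
import Literature.Analysis.Complex.RectangleCauchyFormula
import HarnessLib

/-!
# The smoothed explicit formula for `ζ_K`, uniformly usable in the number field

Topic `Literature/NumberTheory/LFunctions`, namespace `Literature.NumberTheory.LFunctions.NumberField`.
Everything here is PROVED; the definitions (`dzEFIntegrand`, `dzEFRemainder`) are glue.

The `χ = 1` companion of `ClassGroupExplicitFormula`: for a number field `K`, an admissible smoothing
`f` with `f(0) = 0` (`F` entire) and `−1/2 < Re s < 3/2`, `s` not a non-trivial zero of `ζ_K`,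

  `Σ_n Λ_K(n) f(log n) n^{−s} = F(s − 1) − Σ_ρ m(ρ) F(s − ρ) − m₀ F(s) + (1/2π) ∫_ℝ (−ζ_K'/ζ_K)(−1/2 + iy) F(s + 1/2 − iy) dy`

(`coefFordK_one_eq_explicit`), `ρ` over the non-trivial zeros of `ζ_K` (absolutely convergent),
`m₀ = ord₀ ζ_K` (`= r₁ + r₂ − 1`). The pole of `ζ_K` at `w = 1` contributes the main term `F(s − 1)`
(Cauchy's formula on the rectangle, `Literature.Analysis.Complex.integral_boundary_rect_div_sub_eq`);
the zeros are handled through the entire `ζ₁_K = (s − 1)ζ_K` (`EntireEF.rectBoundaryIntegral_neg_logDeriv_mul_eq`).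
This is the exact form of Thorner–Zaman's Lemma 4.3 for the trivial character.

## References

* J. Thorner, A. Zaman, ANT 13 (2019), Lemma 4.3. [ThornerZaman2019]
* K. Ford, *Zero-free regions for the Riemann zeta function* (2002), Lemma 4.5. [Ford2002Millennium]
-/

noncomputable section

open Complex Real MeasureTheory Set Filter Topology ArithmeticFunction
open scoped LSeries.notation NumberField nonZeroDivisors

namespace Literature.NumberTheory.LFunctions.NumberField

open Literature.NumberTheory.LFunctions.EntireEF Literature.NumberTheory.LFunctions.LogFreeDensity
  Literature.NumberTheory.LFunctions.LogFreeLocal Literature.Analysis.Complex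

variable {K : Type} [Field K] [NumberField K]

/-! ## The integrand and the zeros of `ζ₁_K` in the rectangle -/

/-- The integrand `G(w) = (−ζ_K'/ζ_K)(w) · F(s − w)` (`ζ_K = L(·, 1)` off `1`). [cite: ThornerZaman2019, Lemma 4.3 (proof)] -/
def dzEFIntegrand (K : Type) [Field K] [NumberField K] (f : ℝ → ℝ) (s w : ℂ) : ℂ :=
  -logDeriv (classGroupLFunction K 1) w * fordLaplace₀ f (s - w)

/-- The left-line integral `J₁(s) = (1/2π) ∫_ℝ G(−1/2 + iy) dy`. [cite: ThornerZaman2019, Lemma 4.3] -/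
def dzEFRemainder (K : Type) [Field K] [NumberField K] (f : ℝ → ℝ) (s : ℂ) : ℂ :=
  (1 / (2 * π) : ℂ) * ∫ y : ℝ, dzEFIntegrand K f s (((-(1 / 2) : ℝ) : ℂ) + y * I)

/-- `ζ₁_K(w) ≠ 0 ⇒ L(w, 1) ≠ 0` and vice versa, for `w ≠ 1`. [folklore] -/
theorem dedekindZeta₁_ne_zero_iff {w : ℂ} (hw : w ≠ 1) : dedekindZeta₁ K w ≠ 0 ↔ classGroupLFunction K 1 w ≠ 0 := by
  rw [dedekindZeta₁_apply_of_ne_one hw, classGroupLFunction_one K hw]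
  constructor
  · intro h h0; exact h (by rw [h0, mul_zero])
  · intro h; exact mul_ne_zero (sub_ne_zero.2 hw) h

/-- **The zeros of `ζ₁_K` with `−1/2 ≤ Re w ≤ 3/2`** are the non-trivial zeros of `ζ_K` or `w = 0`. [folklore] -/
theorem zero_dedekindZeta₁_cases {w : ℂ} (h0 : dedekindZeta₁ K w = 0) (hre1 : -(1 / 2) ≤ w.re) (hre2 : w.re ≤ 3 / 2) :
    (0 < w.re ∧ w.re < 1) ∨ w = 0 := by
  by_cases hZ : ∃ n : ℤ, w = n
  · obtain ⟨n, rfl⟩ := hZ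
    right
    have h1 : (n : ℂ).re = n := by simp
    rw [h1] at hre1 hre2
    have hn0 : -1 < n := by
      have : (-1 : ℝ) < n := by linarith
      exact_mod_cast this
    have hn1 : n < 2 := by
      have : (n : ℝ) < 2 := by linarith
      exact_mod_cast this
    interval_cases n
    · norm_num
    · exfalso
      have h1 : (1 : ℝ) ≤ ((1 : ℤ) : ℂ).re := by norm_num
      exact dedekindZeta₁_ne_zero_of_one_le_re (K := K) h1 h0
  · push Not at hZ
    left
    have hwZ : ∀ n : ℤ, w ≠ n := fun n h ↦ hZ n h
    have hw1 : w ≠ 1 := fun h ↦ hwZ 1 (by simpa using h)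
    have hlt1 : w.re < 1 := by
      by_contra hge; rw [not_lt] at hge
      exact dedekindZeta₁_ne_zero_of_one_le_re hge h0
    refine ⟨?_, hlt1⟩
    by_contra hle; rw [not_lt] at hle
    have h1w1 : 1 - w ≠ 1 := fun h ↦ hwZ 0 (by simp at h ⊢; exact h)
    have hζ' : dedekindZeta₁ K (1 - w) ≠ 0 := dedekindZeta₁_ne_zero_of_one_le_re (by simp; linarith)
    have hL' : classGroupLFunction K (1 : ClassGroup (𝓞 K) →* ℂˣ)⁻¹ (1 - w) ≠ 0 := by
      rw [show (1 : ClassGroup (𝓞 K) →* ℂˣ)⁻¹ = 1 by ext C; simp]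
      exact (dedekindZeta₁_ne_zero_iff h1w1).1 hζ'
    have hLw := (logDeriv_classGroupLFunction_reflect (1 : ClassGroup (𝓞 K) →* ℂˣ) hwZ hL').1
    exact ((dedekindZeta₁_ne_zero_iff hw1).2 hLw) h0

/-- At a good height no zero of `ζ₁_K` lies on the boundary of `[−1/2, 3/2] × [−T, T]`. [folklore] -/
theorem rect_boundary_free_dedekindZeta₁ {T : ℝ} (hT : 0 < T)
    (hgood : ∀ ρ : ℂ, dedekindZeta₁ K ρ = 0 → 0 < ρ.re → ρ.re < 1 → ρ.im ≠ T ∧ ρ.im ≠ -T) :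
    ∀ ρ : ℂ, dedekindZeta₁ K ρ = 0 → ρ.re ∈ Icc (-(1 / 2) : ℝ) (3 / 2) → ρ.im ∈ Icc (-T) T →
      ρ.re ∈ Ioo (-(1 / 2) : ℝ) (3 / 2) ∧ ρ.im ∈ Ioo (-T) T := by
  intro ρ h0 hre him
  rcases zero_dedekindZeta₁_cases h0 hre.1 hre.2 with ⟨h1, h2⟩ | rfl
  · obtain ⟨ha, hb⟩ := hgood ρ h0 h1 h2
    refine ⟨⟨by linarith, by linarith⟩, ?_⟩
    exact ⟨lt_of_le_of_ne him.1 (Ne.symm hb), lt_of_le_of_ne him.2 ha⟩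
  · simp only [Complex.zero_re, Complex.zero_im, mem_Ioo]
    exact ⟨⟨by norm_num, by norm_num⟩, ⟨by linarith, hT⟩⟩

/-! ## The contour identity: zeros of `ζ₁_K` and the pole at `1` -/

/-- On the contour, `(−ζ_K'/ζ_K) F = (−ζ₁_K'/ζ₁_K) F + F/(w − 1)`. [folklore] -/
theorem dzEFIntegrand_eq {f : ℝ → ℝ} {s w : ℂ} (hw : w ≠ 1) (hζ : dedekindZeta₁ K w ≠ 0) :
    dzEFIntegrand K f s w = -logDeriv (dedekindZeta₁ K) w * fordLaplace₀ f (s - w) + fordLaplace₀ f (s - w) / (w - 1) := by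
  rw [dzEFIntegrand, (logDeriv_classGroupLFunction_one_eq hw hζ).2]
  ring

/-- **The contour identity for `ζ_K`**: `f` continuous vanishing on `[x₀, ∞)` with `f(0) = 0`, `T > 0` a
good height. Then `∮ G = 2πi (Σ_{ρ ∈ rect, ζ₁(ρ)=0} (−m(ρ)) F(s − ρ) + F(s − 1))`.
[cite: Ford2002Millennium, Lemma 4.5 (proof)] -/
theorem dzEF_contour_identity {f : ℝ → ℝ} {x₀ : ℝ} (hfc : Continuous f) (hx₀ : 0 ≤ x₀) (hf0 : ∀ u, x₀ ≤ u → f u = 0)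
    (hf00 : f 0 = 0) (s : ℂ) {T : ℝ} (hT : 0 < T)
    (hgood : ∀ ρ : ℂ, dedekindZeta₁ K ρ = 0 → 0 < ρ.re → ρ.re < 1 → ρ.im ≠ T ∧ ρ.im ≠ -T) :
    rectBoundaryIntegral (dzEFIntegrand K f s) (-(1 / 2)) (3 / 2) (-T) T =
      2 * π * I * (∑ ρ ∈ rectZeros (dedekindZeta₁_differentiable K) (dedekindZeta₁_ne_zero_of_one_le_re (K := K) (s := 2) (by norm_num))
        (-(1 / 2)) (3 / 2) T, (-(analyticOrderNatAt (dedekindZeta₁ K) ρ : ℂ) * fordLaplace₀ f (s - ρ)) + fordLaplace₀ f (s - 1)) := by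
  set ζ₁ := dedekindZeta₁ K with hζ₁
  have hdf : Differentiable ℂ ζ₁ := dedekindZeta₁_differentiable K
  have hc2 : ζ₁ 2 ≠ 0 := dedekindZeta₁_ne_zero_of_one_le_re (by norm_num)
  set Φ : ℂ → ℂ := fun w ↦ fordLaplace₀ f (s - w) with hΦdef
  have hΦ : Differentiable ℂ Φ := by
    have hF := differentiable_fordLaplace hfc hx₀ hf0
    intro w
    have : Φ = fun w ↦ fordLaplace f (s - w) := by
      funext w; exact fordLaplace₀_eq_fordLaplace hf00 _
    rw [this]
    exact (hF (s - w)).comp w ((differentiableAt_const _).sub differentiableAt_id)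
  have hbdry := rect_boundary_free_dedekindZeta₁ (K := K) hT hgood
  show _ = 2 * π * I * (∑ ρ ∈ rectZeros hdf hc2 (-(1 / 2)) (3 / 2) T, (-(analyticOrderNatAt ζ₁ ρ : ℂ) * Φ ρ) + Φ 1)
  -- the two pieces
  set G₁ : ℂ → ℂ := fun w ↦ -logDeriv ζ₁ w * Φ w with hG₁
  set G₂ : ℂ → ℂ := fun w ↦ Φ w / (w - 1) with hG₂
  -- no zeros / no pole on the boundary ⇒ the integrand equals `G₁ + G₂` there and both are continuous there
  have hbd_pts : ∀ w : ℂ, (w.re = -(1 / 2) ∨ w.re = 3 / 2 ∨ w.im = T ∨ w.im = -T) →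
      w.re ∈ Icc (-(1 / 2) : ℝ) (3 / 2) → w.im ∈ Icc (-T) T → ζ₁ w ≠ 0 ∧ w ≠ 1 := by
    intro w hw hre him
    refine ⟨fun h0 ↦ ?_, fun h1 ↦ ?_⟩
    · obtain ⟨hre', him'⟩ := hbdry w h0 hre him
      rcases hw with h | h | h | h
      · linarith [hre'.1]
      · linarith [hre'.2]
      · linarith [him'.2]
      · linarith [him'.1]
    · rw [h1] at hw; simp at hw
      rcases hw with h | h | h | h <;> [norm_num at h; norm_num at h; linarith; linarith]
  have hcontG₁ : ∀ w : ℂ, ζ₁ w ≠ 0 → ContinuousAt G₁ w := by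
    intro w hw
    have han : AnalyticAt ℂ ζ₁ w := hdf.analyticAt w
    have h1 : ContinuousAt (fun z ↦ deriv ζ₁ z / ζ₁ z) w := han.deriv.continuousAt.div han.continuousAt hw
    have h2 : logDeriv ζ₁ = fun z ↦ deriv ζ₁ z / ζ₁ z := by funext z; rw [logDeriv_apply]
    have hld : ContinuousAt (logDeriv ζ₁) w := by rw [h2]; exact h1
    exact hld.neg.mul (hΦ w).continuousAt
  have hcontG₂ : ∀ w : ℂ, w ≠ 1 → ContinuousAt G₂ w := fun w hw ↦
    (hΦ w).continuousAt.div (continuousAt_id.sub continuousAt_const) (sub_ne_zero.2 hw)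
  have hab : (-(1 / 2) : ℝ) ≤ 3 / 2 := by norm_num
  have hcd : -T ≤ T := by linarith
  -- congruence on the boundary
  have hcongr : rectBoundaryIntegral (dzEFIntegrand K f s) (-(1 / 2)) (3 / 2) (-T) T =
      rectBoundaryIntegral (fun w ↦ G₁ w + G₂ w) (-(1 / 2)) (3 / 2) (-T) T := by
    refine rectBoundaryIntegral_congr hab hcd (fun x hx ↦ ?_) (fun x hx ↦ ?_) (fun y hy ↦ ?_) (fun y hy ↦ ?_)
    · obtain ⟨hz, h1⟩ := hbd_pts (x + (-T : ℝ) * I) (by simp) (by simpa using hx) (by simp [hT.le])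
      simpa [hG₁, hG₂] using dzEFIntegrand_eq (f := f) (s := s) h1 hz
    · obtain ⟨hz, h1⟩ := hbd_pts (x + (T : ℝ) * I) (by simp) (by simpa using hx) (by simp [hT.le])
      simpa [hG₁, hG₂] using dzEFIntegrand_eq (f := f) (s := s) h1 hz
    · obtain ⟨hz, h1⟩ := hbd_pts (((-(1 / 2) : ℝ) : ℂ) + y * I) (by simp) (by simp; norm_num) (by simpa using hy)
      simpa [hG₁, hG₂] using dzEFIntegrand_eq (f := f) (s := s) h1 hz
    · obtain ⟨hz, h1⟩ := hbd_pts (((3 / 2 : ℝ) : ℂ) + y * I) (by simp) (by simp; norm_num) (by simpa using hy)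
      simpa [hG₁, hG₂] using dzEFIntegrand_eq (f := f) (s := s) h1 hz
  rw [hcongr, rectBoundaryIntegral_add hab hcd]
  rotate_left
  · intro x hx
    exact hcontG₁ _ (hbd_pts _ (by simp) (by simpa using hx) (by simp [hT.le])).1
  · intro x hx
    exact hcontG₁ _ (hbd_pts _ (by simp) (by simpa using hx) (by simp [hT.le])).1
  · intro y hy
    exact hcontG₁ _ (hbd_pts _ (by simp) (by simp; norm_num) (by simpa using hy)).1
  · intro y hy
    exact hcontG₁ _ (hbd_pts _ (by simp) (by simp; norm_num) (by simpa using hy)).1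
  · intro x hx
    exact hcontG₂ _ (hbd_pts _ (by simp) (by simpa using hx) (by simp [hT.le])).2
  · intro x hx
    exact hcontG₂ _ (hbd_pts _ (by simp) (by simpa using hx) (by simp [hT.le])).2
  · intro y hy
    exact hcontG₂ _ (hbd_pts _ (by simp) (by simp; norm_num) (by simpa using hy)).2
  · intro y hy
    exact hcontG₂ _ (hbd_pts _ (by simp) (by simp; norm_num) (by simpa using hy)).2
  -- the zeros
  have h1 := rectBoundaryIntegral_neg_logDeriv_mul_eq hdf hc2 hΦ (a := -(1 / 2)) (b := 3 / 2) (by norm_num) hT hbdry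
  -- the pole: Cauchy's formula for the entire `Φ`
  have h2 : rectBoundaryIntegral G₂ (-(1 / 2)) (3 / 2) (-T) T = 2 * π * I * Φ 1 := by
    have h := integral_boundary_rect_div_sub_eq (f := Φ) 1 (a := -(1 / 2)) (b := 3 / 2) (c := -T) (d := T)
      (by simp; norm_num) (by simp; norm_num) (by simp; linarith) (by simp; exact hT) (hΦ.differentiableOn)
    rw [rectBoundaryIntegral]
    simpa [hG₂] using h
  rw [h1, h2]
  ring


/-! ## Absolute convergence of the zero sum -/

/-- The non-trivial zeros stay at a positive distance from a point `s` that is not one of them. [folklore] -/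
theorem exists_dist_dzZeros_ge {s : ℂ}
    (hsz : ∀ ρ : ℂ, dedekindZeta₁ K ρ = 0 → 0 < ρ.re → ρ.re < 1 → ρ ≠ s) :
    ∃ d : ℝ, 0 < d ∧ d ≤ 1 ∧ ∀ ρ ∈ nontrivialZeros (dedekindZeta₁ K), d ≤ ‖s - ρ‖ := by
  classical
  have hfin := finite_zeroBox_dedekindZeta₁ (K := K) (|s.im| + 1)
  set A : Finset ℝ := insert 1 (hfin.toFinset.image fun ρ ↦ ‖s - ρ‖) with hA
  have hne : A.Nonempty := ⟨1, Finset.mem_insert_self _ _⟩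
  have hpos : ∀ a ∈ A, 0 < a := by
    intro a ha
    rw [hA, Finset.mem_insert, Finset.mem_image] at ha
    rcases ha with rfl | ⟨ρ, hρ, rfl⟩
    · exact one_pos
    · rw [Set.Finite.mem_toFinset] at hρ
      exact norm_pos_iff.2 (sub_ne_zero.2 (Ne.symm (hsz ρ hρ.1 hρ.2.1 hρ.2.2.1)))
  refine ⟨A.min' hne, hpos _ (Finset.min'_mem _ _), Finset.min'_le _ _ (Finset.mem_insert_self _ _), fun ρ hρ ↦ ?_⟩
  by_cases hγ : |ρ.im| ≤ |s.im| + 1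
  · refine Finset.min'_le _ _ ?_
    rw [hA, Finset.mem_insert, Finset.mem_image]
    refine Or.inr ⟨ρ, ?_, rfl⟩
    rw [Set.Finite.mem_toFinset]
    exact ⟨hρ.1, hρ.2.1, hρ.2.2, hγ⟩
  · push Not at hγ
    have h1 : (1 : ℝ) ≤ ‖s - ρ‖ := by
      have := Complex.abs_im_le_norm (s - ρ)
      rw [sub_im] at this
      have h2 : |ρ.im| - |s.im| ≤ |s.im - ρ.im| := by
        have := abs_sub_abs_le_abs_sub ρ.im s.im
        rwa [abs_sub_comm] at this
      linarith
    exact (Finset.min'_le _ _ (Finset.mem_insert_self _ _)).trans h1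

/-- The window bound in the abstract form: `Σ_{window} m ≤ 512(n_K+1)(A + log(|τ| + 4))`, `A = log|d_K| + 3n_K`. [folklore] -/
theorem window_bound_dedekindZeta₁ (τ : ℝ) (P : Finset ℂ)
    (hP : ∀ ρ ∈ P, dedekindZeta₁ K ρ = 0 ∧ 0 < ρ.re ∧ ρ.re < 1 ∧ |ρ.im - τ| ≤ 1 / 2) :
    ∑ ρ ∈ P, (analyticOrderNatAt (dedekindZeta₁ K) ρ : ℝ) ≤
      (512 * (Module.finrank ℚ K + 1)) * ((Real.log ((NumberField.discr K).natAbs : ℝ) + 3 * Module.finrank ℚ K) + Real.log (|τ| + 4)) := by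
  have h := (sum_window_dedekindZeta₁_le (K := K) τ P hP).trans (show (64 : ℝ) * discBound K τ ≤ 256 * discBound K τ by
    have := one_le_discBound K τ; nlinarith)
  simp only [zeroOrder] at h
  refine h.trans ?_
  rw [discBound]
  have hl := log_abs_add_seven_le τ
  have hd : 0 ≤ Real.log ((NumberField.discr K).natAbs : ℝ) := Real.log_natCast_nonneg _
  have hn : (0 : ℝ) ≤ Module.finrank ℚ K := Nat.cast_nonneg _
  have hl4 : 0 ≤ Real.log (|τ| + 4) := Real.log_nonneg (by linarith [abs_nonneg τ])
  have hl7 : 0 ≤ Real.log (|τ| + 7) := Real.log_nonneg (by linarith [abs_nonneg τ])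
  nlinarith [mul_nonneg hn hl4, mul_nonneg hn hl7, mul_le_mul_of_nonneg_left hl hn]

/-- **Absolute convergence of the zero sum** `Σ_ρ m(ρ) F(s − ρ)` (`χ ≠ 1`, admissible `f` with `f(0) = 0`,
`Re s > −1`, `s` not a non-trivial zero). [cite: HeathBrown1992PLMS, Lemma 5.1] -/
theorem summable_norm_dzZeroTerm {f p p' p'' : ℝ → ℝ} {x₀ : ℝ}
    (h : IsSmoothedEFTest f p p' p'' x₀) {s : ℂ} (hσ₁ : -1 < s.re)
    (hsz : ∀ ρ : ℂ, dedekindZeta₁ K ρ = 0 → 0 < ρ.re → ρ.re < 1 → ρ ≠ s) :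
    Summable fun ρ : nontrivialZeros (dedekindZeta₁ K) ↦
      ‖(analyticOrderNatAt (dedekindZeta₁ K) (ρ : ℂ) : ℂ) * fordLaplace₀ f (s - ρ)‖ := by
  obtain ⟨d, hd0, hd1, hd⟩ := exists_dist_dzZeros_ge hsz
  set D := SmoothedEF.decayConst p' p'' x₀ with hD
  have hD0 : 0 ≤ D := SmoothedEF.decayConst_nonneg h.x₀_nonneg
  set C : ℝ := (1 + 2 * s.im ^ 2) / d ^ 2 + 2 with hC
  have hA0 : 0 ≤ Real.log ((NumberField.discr K).natAbs : ℝ) + 3 * Module.finrank ℚ K := by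
    have : 0 ≤ Real.log ((NumberField.discr K).natAbs : ℝ) := Real.log_natCast_nonneg _
    positivity
  refine summable_of_norm_le_mul_div (by positivity) hA0 (window_bound_dedekindZeta₁ (K := K)) (B := D * C) fun ρ ↦ ?_
  have hm : (0 : ℝ) ≤ analyticOrderNatAt (dedekindZeta₁ K) (ρ : ℂ) := Nat.cast_nonneg _
  have hρ := ρ.2
  have hre0 := hρ.2.1
  have hre1 := hρ.2.2
  have hdρ := hd _ hρ
  have hne : s - (ρ : ℂ) ≠ 0 := norm_pos_iff.1 (hd0.trans_le hdρ)
  have hF := SmoothedEF.norm_fordLaplace₀_le h hne (by rw [sub_re]; linarith)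
  rw [norm_mul, Complex.norm_natCast]
  have hd2 : d ^ 2 ≤ ‖s - ρ‖ ^ 2 := by nlinarith [norm_nonneg (s - (ρ : ℂ))]
  have hkey : 1 + (ρ : ℂ).im ^ 2 ≤ C * ‖s - ρ‖ ^ 2 := by
    have hn2 : (s.im - (ρ : ℂ).im) ^ 2 ≤ ‖s - ρ‖ ^ 2 := by
      have := Complex.abs_im_le_norm (s - ρ)
      rw [sub_im] at this
      nlinarith [abs_nonneg (s.im - (ρ : ℂ).im), sq_abs (s.im - (ρ : ℂ).im)]
    have h1 : (ρ : ℂ).im ^ 2 ≤ 2 * (s.im - (ρ : ℂ).im) ^ 2 + 2 * s.im ^ 2 := by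
      nlinarith [sq_nonneg (s.im - 2 * (ρ : ℂ).im), sq_nonneg ((ρ : ℂ).im - 2 * s.im), sq_nonneg (2 * s.im - (ρ : ℂ).im)]
    have h2 : 1 + 2 * s.im ^ 2 ≤ (1 + 2 * s.im ^ 2) / d ^ 2 * ‖s - ρ‖ ^ 2 := by
      rw [div_mul_eq_mul_div, le_div_iff₀ (by positivity)]
      exact mul_le_mul_of_nonneg_left hd2 (by positivity)
    calc 1 + (ρ : ℂ).im ^ 2 ≤ (1 + 2 * s.im ^ 2) + 2 * (s.im - (ρ : ℂ).im) ^ 2 := by linarith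
      _ ≤ (1 + 2 * s.im ^ 2) / d ^ 2 * ‖s - ρ‖ ^ 2 + 2 * ‖s - ρ‖ ^ 2 := by linarith
      _ = C * ‖s - ρ‖ ^ 2 := by rw [hC]; ring
  have hpos : 0 < ‖s - (ρ : ℂ)‖ ^ 2 := by positivity
  calc (analyticOrderNatAt (dedekindZeta₁ K) (ρ : ℂ) : ℝ) * ‖fordLaplace₀ f (s - ρ)‖
      ≤ (analyticOrderNatAt (dedekindZeta₁ K) (ρ : ℂ) : ℝ) * (D / ‖s - ρ‖ ^ 2) := mul_le_mul_of_nonneg_left hF hm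
    _ ≤ (analyticOrderNatAt (dedekindZeta₁ K) (ρ : ℂ) : ℝ) * (D * C / (1 + (ρ : ℂ).im ^ 2)) := by
        refine mul_le_mul_of_nonneg_left ?_ hm
        rw [div_le_div_iff₀ hpos (by positivity)]
        calc D * (1 + (ρ : ℂ).im ^ 2) ≤ D * (C * ‖s - ρ‖ ^ 2) := mul_le_mul_of_nonneg_left hkey hD0
          _ = D * C * ‖s - ρ‖ ^ 2 := by ring
    _ = D * C * ((analyticOrderNatAt (dedekindZeta₁ K) (ρ : ℂ) : ℝ) / (1 + (ρ : ℂ).im ^ 2)) := by ring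

/-! ## The left line `Re w = −1/2` -/

/-- `L(·, 1) ≠ 0` on `Re w = −1/2` (so `ζ_K ≠ 0` there), with the two spellings of the point. [folklore] -/
theorem classGroupLFunction_one_leftLine_ne_zero (y : ℝ) :
    classGroupLFunction K 1 (((-(1 / 2) : ℝ) : ℂ) + y * I) ≠ 0 ∧ (((-(1 / 2) : ℝ) : ℂ) + y * I) ≠ 1 ∧
      logDeriv (classGroupLFunction K 1) (((-(1 / 2) : ℝ) : ℂ) + y * I) =
        logDeriv (classGroupLFunction K 1) (-1 / 2 + y * I) := by
  set w : ℂ := ((-(1 / 2) : ℝ) : ℂ) + y * I with hw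
  have hwre : w.re = -1 / 2 := by simp [hw]; norm_num
  have hwZ : ∀ n : ℤ, w ≠ n := fun n h ↦ by
    have := congrArg Complex.re h
    rw [hwre] at this; simp at this
    have h2 : (2 * n : ℝ) = -1 := by linarith
    have h3 : (2 * n : ℤ) = -1 := by exact_mod_cast h2
    omega
  have hw1 : w ≠ 1 := fun h ↦ hwZ 1 (by rw [h]; simp)
  have h1w1 : 1 - w ≠ 1 := fun h ↦ hwZ 0 (by simp at h ⊢; exact h)
  have hL' : classGroupLFunction K (1 : ClassGroup (𝓞 K) →* ℂˣ)⁻¹ (1 - w) ≠ 0 := by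
    rw [show (1 : ClassGroup (𝓞 K) →* ℂˣ)⁻¹ = 1 by ext C; simp]
    exact (dedekindZeta₁_ne_zero_iff h1w1).1 (dedekindZeta₁_ne_zero_of_one_le_re (by simp [hwre]; norm_num))
  have hLw := (logDeriv_classGroupLFunction_reflect (1 : ClassGroup (𝓞 K) →* ℂˣ) hwZ hL').1
  have hw' : w = -1 / 2 + y * I := by rw [hw]; push_cast; ring
  exact ⟨hLw, hw1, by rw [hw']⟩

/-- The integrand `y ↦ G(−1/2 + iy)` is continuous (`χ ≠ 1`, `Re s > −1/2`, `f(0) = 0`). [folklore] -/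
theorem continuous_dzIntegrand_left {f : ℝ → ℝ} {x₀ : ℝ}
    (hfc : Continuous f) (hx₀ : 0 ≤ x₀) (hf0 : ∀ u, x₀ ≤ u → f u = 0) (hf00 : f 0 = 0) (s : ℂ) :
    Continuous fun y : ℝ ↦ dzEFIntegrand K f s (((-(1 / 2) : ℝ) : ℂ) + y * I) := by
  set Lv : ℝ → ℂ := fun y : ℝ ↦ (((-(1 / 2) : ℝ) : ℂ) + y * I) with hLv
  have hline : Continuous Lv := by rw [hLv]; fun_prop
  have hcomp : (fun y : ℝ ↦ dzEFIntegrand K f s (((-(1 / 2) : ℝ) : ℂ) + y * I)) =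
      (fun w ↦ -logDeriv (classGroupLFunction K 1) w * fordLaplace₀ f (s - w)) ∘ Lv := rfl
  rw [hcomp]
  refine continuous_iff_continuousAt.2 fun y ↦ ContinuousAt.comp (x := y) ?_ hline.continuousAt
  obtain ⟨hL, hw1, -⟩ := classGroupLFunction_one_leftLine_ne_zero (K := K) y
  have han : AnalyticAt ℂ (classGroupLFunction K 1) (Lv y) := analyticAt_classGroupLFunction 1 hw1
  have hF := differentiable_fordLaplace hfc hx₀ hf0
  have hΦ : ContinuousAt (fun w ↦ fordLaplace₀ f (s - w)) (Lv y) := by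
    have : (fun w ↦ fordLaplace₀ f (s - w)) = fun w ↦ fordLaplace f (s - w) := by
      funext w; exact fordLaplace₀_eq_fordLaplace hf00 _
    rw [this]
    exact ((hF (s - Lv y)).comp (Lv y) ((differentiableAt_const _).sub differentiableAt_id)).continuousAt
  have hld : ContinuousAt (logDeriv (classGroupLFunction K 1)) (Lv y) := by
    have h1 : ContinuousAt (fun z ↦ deriv (classGroupLFunction K 1) z / classGroupLFunction K 1 z) (Lv y) :=
      han.deriv.continuousAt.div han.continuousAt hL
    have h2 : logDeriv (classGroupLFunction K 1) = fun z ↦ deriv (classGroupLFunction K 1) z / classGroupLFunction K 1 z := by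
      funext z; rw [logDeriv_apply]
    rw [h2]; exact h1
  exact hld.neg.mul hΦ

/-- **The left-line integrand is integrable on `ℝ`** (`χ ≠ 1`, `Re s > −1/2`):
`|L'/L(−1/2 + iy)| ≪ log|d_K| + log(|y| + 4)` against `|F| ≤ D/((σ + 1/2)² + (t − y)²)`. [folklore] -/
theorem integrable_dzIntegrand_left {f p p' p'' : ℝ → ℝ} {x₀ : ℝ}
    (h : IsSmoothedEFTest f p p' p'' x₀) (hf00 : f 0 = 0) {s : ℂ} (hσ₁ : -(1 / 2) < s.re) :
    Integrable fun y : ℝ ↦ dzEFIntegrand K f s (((-(1 / 2) : ℝ) : ℂ) + y * I) := by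
  obtain ⟨A, hA0, hA⟩ := exists_norm_logDeriv_classGroupLFunction_left_le
  set D := SmoothedEF.decayConst p' p'' x₀ with hD
  have hD0 : 0 ≤ D := SmoothedEF.decayConst_nonneg h.x₀_nonneg
  set n : ℝ := (Module.finrank ℚ K : ℝ) with hn
  have hn0 : 0 ≤ n := Nat.cast_nonneg _
  have hd0 : 0 ≤ Real.log ((NumberField.discr K).natAbs : ℝ) := Real.log_natCast_nonneg _
  set M : ℝ := A * (n + 1) with hM
  have hM0 : 0 ≤ M := by positivity
  set A₀ : ℝ := Real.log ((NumberField.discr K).natAbs : ℝ) + Real.log 4 with hA₀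
  have hA₀0 : 0 ≤ A₀ := by have : 0 ≤ Real.log 4 := Real.log_nonneg (by norm_num); positivity
  set a : ℝ := s.re + 1 / 2 with ha
  have ha0 : 0 < a := by rw [ha]; linarith
  refine (((SmoothedEF.integrable_left_majorant' (A := A₀) hA₀0 ha0 (t := s.im)).const_mul (M * D))).mono'
    (continuous_dzIntegrand_left h.cont h.x₀_nonneg h.eq_zero hf00 s).aestronglyMeasurable (ae_of_all _ fun y ↦ ?_)
  set w : ℂ := ((-(1 / 2) : ℝ) : ℂ) + y * I with hw
  have hsw_re : (s - w).re = a := by simp [hw, ha]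
  have hsw_im : (s - w).im = s.im - y := by simp [hw]
  have hsw : s - w ≠ 0 := fun h0 ↦ by
    have := congrArg Complex.re h0
    rw [hsw_re, Complex.zero_re] at this
    linarith
  have hnorm : ‖s - w‖ ^ 2 = a ^ 2 + (s.im - y) ^ 2 := by
    rw [Complex.sq_norm, Complex.normSq_apply, hsw_re, hsw_im]; ring
  have hF : ‖fordLaplace₀ f (s - w)‖ ≤ D / (a ^ 2 + (s.im - y) ^ 2) := by
    rw [← hnorm]
    exact SmoothedEF.norm_fordLaplace₀_le h hsw (by rw [hsw_re]; linarith)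
  rw [dzEFIntegrand, norm_mul, norm_neg, (classGroupLFunction_one_leftLine_ne_zero (K := K) y).2.2]
  have hb := hA K 1 y
  have hlog4 : Real.log (|y| + 4) ≤ Real.log 4 + Real.log (1 + |y|) := by
    rw [← Real.log_mul (by norm_num) (by linarith [abs_nonneg y])]
    exact Real.log_le_log (by linarith [abs_nonneg y]) (by nlinarith [abs_nonneg y])
  have hl1 : 0 ≤ Real.log (1 + |y|) := Real.log_nonneg (by linarith [abs_nonneg y])
  have hb' : ‖logDeriv (classGroupLFunction K 1) (-1 / 2 + y * I)‖ ≤ M * (A₀ + 2 * Real.log (1 + |y|)) := by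
    refine hb.trans ?_
    rw [hM, hA₀, ← hn]
    have : Real.log ((NumberField.discr K).natAbs : ℝ) + Real.log (|y| + 4) ≤
        Real.log ((NumberField.discr K).natAbs : ℝ) + Real.log 4 + 2 * Real.log (1 + |y|) := by linarith
    exact mul_le_mul_of_nonneg_left this (by positivity)
  have hC1 : 0 ≤ M * (A₀ + 2 * Real.log (1 + |y|)) := by positivity
  calc ‖logDeriv (classGroupLFunction K 1) (-1 / 2 + y * I)‖ * ‖fordLaplace₀ f (s - w)‖
      ≤ (M * (A₀ + 2 * Real.log (1 + |y|))) * (D / (a ^ 2 + (s.im - y) ^ 2)) := mul_le_mul hb' hF (norm_nonneg _) hC1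
    _ = M * D * ((A₀ + 2 * Real.log (1 + |y|)) / (a ^ 2 + (s.im - y) ^ 2)) := by ring

/-! ## The right line `Re w = 3/2` -/

/-- On the right line the integrand is that of the prime side:
`∫_ℝ G(3/2 + iv) dv = 2π K_{f,Λ_χ}(s)` and the integrand is integrable (`Re s < 3/2`). [folklore] -/
theorem integral_dzIntegrand_right {f p p' p'' : ℝ → ℝ} {x₀ : ℝ}
    (h : IsSmoothedEFTest f p p' p'' x₀) {s : ℂ} (hσ₂ : s.re < 3 / 2) :
    Integrable (fun v : ℝ ↦ dzEFIntegrand K f s (((3 / 2 : ℝ) : ℂ) + v * I)) ∧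
      ∫ v : ℝ, dzEFIntegrand K f s (((3 / 2 : ℝ) : ℂ) + v * I) = 2 * π * coefFordK (cgCoef (1 : ClassGroup (𝓞 K) →* ℂˣ)) f s := by
  have hα : (1 : ℝ) < 3 / 2 := by norm_num
  have hint : Integrable fun y : ℝ ↦ fordLaplace₀ f ((s.re - 3 / 2 : ℝ) + y * I) :=
    SmoothedEF.integrable_vertical h (by linarith)
  have ha : ∀ n, ‖cgCoef (1 : ClassGroup (𝓞 K) →* ℂˣ) n‖ ≤ (Module.finrank ℚ K : ℝ) * Λ n := norm_cgCoef_le (1 : ClassGroup (𝓞 K) →* ℂˣ)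
  have heq : (fun v : ℝ ↦ dzEFIntegrand K f s (((3 / 2 : ℝ) : ℂ) + v * I)) = fun v : ℝ ↦
      L (cgCoef (1 : ClassGroup (𝓞 K) →* ℂˣ)) (((3 / 2 : ℝ) : ℂ) + v * I) * fordLaplace₀ f (s - ((3 / 2 : ℝ) + v * I)) := by
    funext v
    set w : ℂ := (((3 / 2 : ℝ)) : ℂ) + v * I with hw
    have h1 : 1 < w.re := by simp [hw]; norm_num
    have hw1 : w ≠ 1 := fun h ↦ by have := congrArg Complex.re h; simp [hw] at this; norm_num at this
    have hζ : dedekindZeta₁ K w ≠ 0 := dedekindZeta₁_ne_zero_of_one_le_re h1.le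
    rw [dzEFIntegrand, (logDeriv_classGroupLFunction_one_eq hw1 hζ).2, logDeriv_dedekindZeta₁_eq h1,
      show cgCoef (1 : ClassGroup (𝓞 K) →* ℂˣ) = fun n ↦ (vonMangoldtNorm K n : ℂ) from twistVonMangoldt_classGroupCharIdealHom_one]
    ring
  rw [heq]
  exact ⟨integrable_LSeries_coef_mul_fordLaplace₀ ha hα hint,
    integral_LSeries_coef_mul_fordLaplace₀ ha h.cont h.eq_zero hα hσ₂ hint⟩

/-! ## The horizontal sides -/

/-- **The horizontal sides are small**: at a height `T` with `|T| ≥ 2`, the zeros of `L₀(·, χ)`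
`η`-separated from `T` and those of `L₀(·, χ⁻¹)` from `−T`, for `|Im s| < |T|` and `Re s > −1/2`:
`‖∫_{−1/2}^{3/2} G(σ + iT) dσ‖ ≤ (3ℒ'_T/η) · D/(|T| − |Im s|)² · 2`. [folklore] -/
theorem norm_integral_dzIntegrand_horizontal_le {f p p' p'' : ℝ → ℝ} {x₀ : ℝ}
    (h : IsSmoothedEFTest f p p' p'' x₀) {s : ℂ} (hσ₁ : -(1 / 2) < s.re) {T η : ℝ} (hT : 2 ≤ |T|) (hsT : |s.im| < |T|)
    (hη : 0 < η) (hη1 : η ≤ 1)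
    (hsep : ∀ ρ : ℂ, dedekindZeta₁ K ρ = 0 → 0 < ρ.re → ρ.re < 1 → η ≤ |ρ.im - T|)
    (hsep' : ∀ ρ : ℂ, dedekindZeta₁ K ρ = 0 → 0 < ρ.re → ρ.re < 1 → η ≤ |ρ.im - -T|) :
    ‖∫ σ : ℝ in (-(1 / 2) : ℝ)..(3 / 2), dzEFIntegrand K f s (σ + T * I)‖ ≤
      4 * lemmaAHeight K T / η * (SmoothedEF.decayConst p' p'' x₀ / (|T| - |s.im|) ^ 2) * 2 := by
  set D := SmoothedEF.decayConst p' p'' x₀ with hD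
  have hD0 : 0 ≤ D := SmoothedEF.decayConst_nonneg h.x₀_nonneg
  have hgap : 0 < |T| - |s.im| := by linarith
  have hT0 : T ≠ 0 := fun h0 ↦ by rw [h0, abs_zero] at hT; linarith
  have hbound : ∀ σ ∈ Set.uIoc (-(1 / 2) : ℝ) (3 / 2), ‖dzEFIntegrand K f s (σ + T * I)‖ ≤
      4 * lemmaAHeight K T / η * (D / (|T| - |s.im|) ^ 2) := by
    intro σ hσ
    rw [Set.uIoc_of_le (by norm_num)] at hσ
    set w : ℂ := (σ : ℂ) + T * I with hw
    have hsw_im : (s - w).im = s.im - T := by simp [hw]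
    have hsw_re : (s - w).re = s.re - σ := by simp [hw]
    have him : |T| - |s.im| ≤ |(s - w).im| := by
      rw [hsw_im]
      have := abs_sub_abs_le_abs_sub T s.im
      rw [abs_sub_comm] at this
      linarith
    have hnorm : |T| - |s.im| ≤ ‖s - w‖ := him.trans (Complex.abs_im_le_norm _)
    have hsw : s - w ≠ 0 := norm_pos_iff.1 (hgap.trans_le hnorm)
    have hF : ‖fordLaplace₀ f (s - w)‖ ≤ D / (|T| - |s.im|) ^ 2 := by
      refine (SmoothedEF.norm_fordLaplace₀_le h hsw (by rw [hsw_re]; linarith [hσ.2])).trans ?_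
      exact div_le_div_of_nonneg_left hD0 (by positivity) (by gcongr)
    obtain ⟨-, hL⟩ := norm_logDeriv_classGroupLFunction_one_le_strip (K := K) hT hη hη1 hsep hsep' hσ.1.le hσ.2
    have hlog : 0 ≤ 4 * lemmaAHeight K T / η := le_trans (norm_nonneg _) hL
    rw [dzEFIntegrand, norm_mul, norm_neg]
    exact mul_le_mul hL hF (norm_nonneg _) hlog
  refine (intervalIntegral.norm_integral_le_of_norm_le_const hbound).trans_eq ?_
  norm_num


/-! ## The zeros in the rectangle: the box of non-trivial zeros and the trivial zero `0` -/

/-- The sum over the zeros of `L₀(·, χ)` in `[−1/2, 3/2] × [−T, T]` splits into the non-trivial zeros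
with `|γ| ≤ T` and the possible trivial zero at `0` (weight `m₀ = ord₀ L₀`, which is `0` when `L₀(0) ≠ 0`).
[folklore] -/
theorem sum_rectZeros_dedekindZeta₁ {T : ℝ} (hT : 0 < T) (g : ℂ → ℂ)
    (hc : dedekindZeta₁ K 2 ≠ 0) :
    ∑ ρ ∈ rectZeros (dedekindZeta₁_differentiable K) hc (-(1 / 2)) (3 / 2) T,
        (-(analyticOrderNatAt (dedekindZeta₁ K) ρ : ℂ) * g ρ) =
      ∑ ρ ∈ (finite_nontrivialZeros_inter (dedekindZeta₁_differentiable K) hc T).toFinset,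
        (-(analyticOrderNatAt (dedekindZeta₁ K) ρ : ℂ) * g ρ) +
      (-(analyticOrderNatAt (dedekindZeta₁ K) 0 : ℂ) * g 0) := by
  classical
  have hdf : Differentiable ℂ (dedekindZeta₁ K) := dedekindZeta₁_differentiable K
  set R := rectZeros hdf hc (-(1 / 2)) (3 / 2) T with hR
  set B := (finite_nontrivialZeros_inter hdf hc T).toFinset with hB
  have hmemB : ∀ ρ, ρ ∈ B ↔ (dedekindZeta₁ K ρ = 0 ∧ 0 < ρ.re ∧ ρ.re < 1) ∧ |ρ.im| ≤ T := by
    intro ρ; rw [hB, Set.Finite.mem_toFinset]; rfl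
  have h0B : (0 : ℂ) ∉ B := fun h ↦ by
    have := ((hmemB 0).1 h).1.2.1; simp at this
  by_cases h0 : dedekindZeta₁ K 0 = 0
  · have hR_eq : R = insert 0 B := by
      ext ρ
      rw [Finset.mem_insert, hmemB, hR, mem_rectZeros]
      constructor
      · rintro ⟨⟨hre, him⟩, hρ0⟩
        rcases zero_dedekindZeta₁_cases hρ0 hre.1 hre.2 with ⟨h1, h2⟩ | h
        · exact Or.inr ⟨⟨hρ0, h1, h2⟩, abs_le.2 ⟨him.1, him.2⟩⟩
        · exact Or.inl h
      · rintro (rfl | ⟨⟨hρ0, h1, h2⟩, him⟩)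
        · refine ⟨⟨⟨by norm_num, by norm_num⟩, ?_⟩, h0⟩
          simp only [Complex.zero_im, mem_Icc]; exact ⟨by linarith, hT.le⟩
        · exact ⟨⟨⟨by linarith, by linarith⟩, abs_le.1 him⟩, hρ0⟩
    rw [hR_eq, Finset.sum_insert h0B, add_comm]
  · have hm0 : analyticOrderNatAt (dedekindZeta₁ K) 0 = 0 := by
      have := (hdf.analyticAt 0).analyticOrderAt_eq_zero.2 h0
      rw [analyticOrderNatAt, this]; rfl
    have hR_eq : R = B := by
      ext ρ
      rw [hmemB, hR, mem_rectZeros]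
      constructor
      · rintro ⟨⟨hre, him⟩, hρ0⟩
        rcases zero_dedekindZeta₁_cases hρ0 hre.1 hre.2 with ⟨h1, h2⟩ | h
        · exact ⟨⟨hρ0, h1, h2⟩, abs_le.2 ⟨him.1, him.2⟩⟩
        · exact absurd hρ0 (h ▸ h0)
      · rintro ⟨⟨hρ0, h1, h2⟩, him⟩
        exact ⟨⟨⟨by linarith, by linarith⟩, abs_le.1 him⟩, hρ0⟩
    rw [hR_eq, hm0]; simp

/-! ## The limit `T → ∞`: the exact explicit formula -/

set_option maxHeartbeats 800000 in
/-- **The smoothed explicit formula for `ζ_K`, exact form** (Thorner–Zaman Lemma 4.3 for the trivial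
character of `Ĉl_K`): for an admissible smoothing `f` with `f(0) = 0` and `−1/2 < Re s < 3/2`, `s` not a
non-trivial zero of `ζ_K`,
`Σ_n Λ_K(n) f(log n) n^{−s} = F(s − 1) − Σ_ρ m(ρ) F(s − ρ) − m₀ F(s) + J₁(s)`, `ρ` over the non-trivial
zeros (absolutely convergent), `m₀ = ord₀ ζ_K`, `J₁` the left-line integral (`dzEFRemainder`).
[cite: ThornerZaman2019, Lemma 4.3] -/
theorem coefFordK_one_eq_explicit {f p p' p'' : ℝ → ℝ} {x₀ : ℝ}
    (h : IsSmoothedEFTest f p p' p'' x₀) (hf00 : f 0 = 0) {s : ℂ} (hσ₁ : -(1 / 2) < s.re) (hσ₂ : s.re < 3 / 2)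
    (hsz : ∀ ρ : ℂ, dedekindZeta₁ K ρ = 0 → 0 < ρ.re → ρ.re < 1 → ρ ≠ s) :
    coefFordK (cgCoef (1 : ClassGroup (𝓞 K) →* ℂˣ)) f s =
      fordLaplace₀ f (s - 1) -
      (∑' ρ : nontrivialZeros (dedekindZeta₁ K),
          (analyticOrderNatAt (dedekindZeta₁ K) (ρ : ℂ) : ℂ) * fordLaplace₀ f (s - ρ)) -
        (analyticOrderNatAt (dedekindZeta₁ K) 0 : ℂ) * fordLaplace₀ f s + dzEFRemainder K f s := by
  have hdf : Differentiable ℂ (dedekindZeta₁ K) := dedekindZeta₁_differentiable K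
  have hc : dedekindZeta₁ K 2 ≠ 0 := dedekindZeta₁_ne_zero_of_one_le_re (by norm_num)
  have hsum := (summable_norm_dzZeroTerm h (by linarith) hsz).of_norm
  set S := ∑' ρ : nontrivialZeros (dedekindZeta₁ K), (analyticOrderNatAt (dedekindZeta₁ K) (ρ : ℂ) : ℂ) * fordLaplace₀ f (s - ρ) with hS
  set m₀F : ℂ := (analyticOrderNatAt (dedekindZeta₁ K) 0 : ℂ) * fordLaplace₀ f s with hm₀F
  -- good heights `T N ∈ [N, N+1]`
  have hgh : ∀ N : ℕ, ∃ T : ℝ, (N : ℝ) ≤ T ∧ T ≤ N + 1 ∧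
      ∀ ρ : ℂ, (dedekindZeta₁ K) ρ = 0 → 0 < ρ.re → ρ.re < 1 → (1 / 1032) / discBound K T ≤ |(|ρ.im|) - T| := by
    intro N
    obtain ⟨T, hT, hsepT⟩ := exists_goodHeight_dedekindZeta₁ (K := K) (τ₀ := N) (Nat.cast_nonneg N)
    exact ⟨T, hT.1, hT.2, hsepT⟩
  choose T hTN hTN1 hsep using hgh
  have hTtop : Tendsto T atTop atTop := tendsto_atTop_mono hTN tendsto_natCast_atTop_atTop
  set η : ℕ → ℝ := fun N ↦ min ((1 / 1032) / discBound K (T N)) 1 with hη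
  have hT0 : ∀ N, 0 ≤ T N := fun N ↦ (Nat.cast_nonneg N).trans (hTN N)
  have hD1 : ∀ N, 1 ≤ discBound K (T N) := fun N ↦ one_le_discBound K (T N)
  have hη0 : ∀ N, 0 < η N := fun N ↦ lt_min (div_pos (by norm_num) (by linarith [hD1 N])) one_pos
  have hη1 : ∀ N, η N ≤ 1 := fun N ↦ min_le_right _ _
  have hηsep : ∀ N, ∀ ρ : ℂ, (dedekindZeta₁ K) ρ = 0 → 0 < ρ.re → ρ.re < 1 → η N ≤ |ρ.im - T N| ∧ η N ≤ |ρ.im + T N| :=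
    fun N ρ h0 h1 h2 ↦ ExplicitPsiChar.dist_of_abs_sub_le (hT0 N) ((min_le_left _ _).trans (hsep N ρ h0 h1 h2))
  have hηsep' : ∀ N, ∀ ρ : ℂ, (dedekindZeta₁ K) ρ = 0 → 0 < ρ.re → ρ.re < 1 → η N ≤ |ρ.im - -T N| := by
    intro N ρ h0 h1 h2
    have := (hηsep N ρ h0 h1 h2).2
    rwa [sub_neg_eq_add]
  obtain ⟨N₀, hN₀⟩ := exists_nat_gt (2 * |s.im| + 2)
  have hbig : ∀ N : ℕ, max N₀ 2 ≤ N → 2 ≤ N ∧ |s.im| + 1 < T N ∧ (N : ℝ) / 2 ≤ T N - |s.im| := by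
    intro N hN
    have hN2 : 2 ≤ N := le_of_max_le_right hN
    have hNN₀ : (N₀ : ℝ) ≤ N := by exact_mod_cast le_of_max_le_left hN
    have hT := hTN N
    refine ⟨hN2, by linarith [abs_nonneg s.im], by linarith [abs_nonneg s.im]⟩
  -- (1) the truncated zero sums
  have hpart : Tendsto (fun N : ℕ ↦ ∑ ρ ∈ zeroFinset hdf hc (T N),
      (analyticOrderNatAt (dedekindZeta₁ K) (ρ : ℂ) : ℂ) * fordLaplace₀ f (s - ρ)) atTop (𝓝 S) :=
    (hsum.hasSum.comp (tendsto_zeroFinset hdf hc)).comp hTtop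
  -- (2) the horizontal sides
  set D := SmoothedEF.decayConst p' p'' x₀ with hD
  have hD0 : 0 ≤ D := SmoothedEF.decayConst_nonneg h.x₀_nonneg
  set B : ℝ := Real.log ((NumberField.discr K).natAbs : ℝ) + 4 * Module.finrank ℚ K + 1 with hB
  have hB1 : 1 ≤ B := by
    have hd : 0 ≤ Real.log ((NumberField.discr K).natAbs : ℝ) := Real.log_natCast_nonneg _
    have hn : (0 : ℝ) ≤ Module.finrank ℚ K := Nat.cast_nonneg _
    rw [hB]; linarith
  set c₁ : ℝ := 77760 * (5 * Module.finrank ℚ K + 2) + 217440 with hc₁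
  have hc₁0 : 0 < c₁ := by positivity
  set Mh : ℝ := 4 * c₁ * B * (1033 * B) * (D * 4) * 2 * 4 with hMh
  have hhor0 : ∀ sgn : ℝ, (sgn = 1 ∨ sgn = -1) →
      Tendsto (fun N : ℕ ↦ ∫ σ : ℝ in (-(1 / 2) : ℝ)..(3 / 2), dzEFIntegrand K f s (σ + ((sgn * T N : ℝ) : ℂ) * I)) atTop (𝓝 0) := by
    intro sgn hsgn
    refine squeeze_zero_norm' ?_ (by simpa using ((ZetaZeroSum.tendsto_log_sq_div.const_mul Mh)))
    filter_upwards [eventually_ge_atTop (max N₀ 2)] with N hN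
    obtain ⟨hN2, hsN, hgapN⟩ := hbig N hN
    have hN2' : (2 : ℝ) ≤ N := by exact_mod_cast hN2
    have hT2 : 2 ≤ T N := by linarith [hTN N]
    have hTpos : 0 < T N := by linarith
    have hTabs : |sgn * T N| = T N := by
      rcases hsgn with rfl | rfl <;> simp [abs_of_pos hTpos]
    -- separation hypotheses at `sgn * T N`
    have hsepN : ∀ ρ : ℂ, (dedekindZeta₁ K) ρ = 0 → 0 < ρ.re → ρ.re < 1 → η N ≤ |ρ.im - sgn * T N| := by
      intro ρ h0 h1 h2
      rcases hsgn with rfl | rfl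
      · simpa using (hηsep N ρ h0 h1 h2).1
      · have := (hηsep N ρ h0 h1 h2).2
        rwa [show ρ.im - -1 * T N = ρ.im + T N by ring]
    have hsepN' : ∀ ρ : ℂ, (dedekindZeta₁ K) ρ = 0 → 0 < ρ.re → ρ.re < 1 → η N ≤ |ρ.im - -(sgn * T N)| := by
      intro ρ h0 h1 h2
      rcases hsgn with rfl | rfl
      · simpa using hηsep' N ρ h0 h1 h2
      · have := (hηsep N ρ h0 h1 h2).1
        rwa [show ρ.im - -(-1 * T N) = ρ.im - T N by ring]
    have hbd := norm_integral_dzIntegrand_horizontal_le h hσ₁ (T := sgn * T N) (η := η N)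
      (by rw [hTabs]; exact hT2) (by rw [hTabs]; linarith) (hη0 N) (hη1 N) hsepN hsepN'
    rw [hTabs] at hbd
    refine hbd.trans ?_
    -- bookkeeping
    set ℓ := Real.log ((N : ℝ) + 7) with hℓ
    have hℓ1 : 1 ≤ ℓ := by
      rw [hℓ, Real.le_log_iff_exp_le (by positivity)]; linarith [Real.exp_one_lt_d9]
    have hlogT : Real.log (T N + 7) ≤ 2 * ℓ := by
      calc Real.log (T N + 7) ≤ Real.log (((N : ℝ) + 7) ^ 2) := by
            refine Real.log_le_log (by linarith) ?_; nlinarith [hTN1 N]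
        _ = 2 * ℓ := by rw [Real.log_pow, hℓ]; norm_num
    have hDisc : discBound K (T N) ≤ B * (2 * ℓ) := by
      have := discBound_le_mul_log (K := K) (T N) (hT0 N)
      rw [← hB] at this
      exact this.trans (mul_le_mul_of_nonneg_left hlogT (by linarith))
    have hLAH : lemmaAHeight K (sgn * T N) = c₁ * discBound K (T N) := by
      rw [lemmaAHeight, ← hc₁, show discBound K (sgn * T N) = discBound K (T N) by rw [discBound, discBound, hTabs, abs_of_pos hTpos]]
    have h1η : 1 / η N ≤ 1033 * B * (2 * ℓ) := by
      have hBl : 1 ≤ B * (2 * ℓ) := by nlinarith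
      have hηN : η N = min ((1 / 1032) / discBound K (T N)) 1 := rfl
      rw [hηN]
      rcases le_total ((1 / 1032) / discBound K (T N)) 1 with hcase | hcase
      · rw [min_eq_left hcase, one_div_div]
        calc discBound K (T N) / (1 / 1032) = 1032 * discBound K (T N) := by ring
          _ ≤ 1032 * (B * (2 * ℓ)) := by nlinarith [hDisc]
          _ ≤ 1033 * B * (2 * ℓ) := by nlinarith
      · rw [min_eq_right hcase, div_one]; nlinarith
    have hN0 : (0 : ℝ) < N := by linarith
    have e1 : 4 * lemmaAHeight K (sgn * T N) / η N ≤ 4 * c₁ * B * (1033 * B) * 4 * ℓ ^ 2 := by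
      rw [hLAH]
      have e0 : 4 * (c₁ * discBound K (T N)) / η N = 4 * c₁ * discBound K (T N) * (1 / η N) := by ring
      rw [e0]
      have hd0 : 0 ≤ discBound K (T N) := by linarith [hD1 N]
      calc 4 * c₁ * discBound K (T N) * (1 / η N) ≤ 4 * c₁ * (B * (2 * ℓ)) * (1033 * B * (2 * ℓ)) :=
            mul_le_mul (mul_le_mul_of_nonneg_left hDisc (by positivity)) h1η (by positivity) (by positivity)
        _ = 4 * c₁ * B * (1033 * B) * 4 * ℓ ^ 2 := by ring
    have hsq' : (N : ℝ) / 4 ≤ (T N - |s.im|) ^ 2 := by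
      have hsq : ((N : ℝ) / 2) ^ 2 ≤ (T N - |s.im|) ^ 2 := pow_le_pow_left₀ (by positivity) hgapN 2
      nlinarith
    have e2 : D / (T N - |s.im|) ^ 2 ≤ D * 4 / N :=
      (div_le_div_of_nonneg_left hD0 (by positivity) hsq').trans_eq (by rw [div_div_eq_mul_div])
    calc 4 * lemmaAHeight K (sgn * T N) / η N * (D / (T N - |s.im|) ^ 2) * 2
        ≤ 4 * c₁ * B * (1033 * B) * 4 * ℓ ^ 2 * (D * 4 / N) * 2 :=
          mul_le_mul_of_nonneg_right (mul_le_mul e1 e2 (by positivity) (by positivity)) (by norm_num)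
      _ = Mh * (ℓ ^ 2 / N) := by rw [hMh]; ring
  -- (3) the vertical sides
  obtain ⟨hIright, hvalright⟩ := integral_dzIntegrand_right (K := K) h hσ₂
  have hright : Tendsto (fun N : ℕ ↦ ∫ y : ℝ in (-T N)..T N, dzEFIntegrand K f s (((3 / 2 : ℝ) : ℂ) + y * I)) atTop
      (𝓝 (2 * π * coefFordK (cgCoef (1 : ClassGroup (𝓞 K) →* ℂˣ)) f s)) := by
    have h3 := intervalIntegral_tendsto_integral hIright (tendsto_neg_atTop_atBot.comp hTtop) hTtop
    rwa [hvalright] at h3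
  have hleft : Tendsto (fun N : ℕ ↦ ∫ y : ℝ in (-T N)..T N, dzEFIntegrand K f s (((-(1 / 2) : ℝ) : ℂ) + y * I)) atTop
      (𝓝 (2 * π * dzEFRemainder K f s)) := by
    have h3 := intervalIntegral_tendsto_integral (integrable_dzIntegrand_left (K := K) h hf00 hσ₁)
      (tendsto_neg_atTop_atBot.comp hTtop) hTtop
    have hval : ∫ y : ℝ, dzEFIntegrand K f s (((-(1 / 2) : ℝ) : ℂ) + y * I) = 2 * π * dzEFRemainder K f s := by
      have hπ : (2 * π : ℂ) ≠ 0 := by simp [Real.pi_ne_zero]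
      rw [dzEFRemainder, ← mul_assoc, mul_one_div_cancel hπ, one_mul]
    rwa [hval] at h3
  -- (4) the boundary integral along `T N` and its two limits
  have hlim1 : Tendsto (fun N : ℕ ↦ rectBoundaryIntegral (dzEFIntegrand K f s) (-(1 / 2)) (3 / 2) (-T N) (T N)) atTop
      (𝓝 (0 - 0 + I * (2 * π * coefFordK (cgCoef (1 : ClassGroup (𝓞 K) →* ℂˣ)) f s) - I * (2 * π * dzEFRemainder K f s))) := by
    have hb := hhor0 (-1) (Or.inr rfl)
    have ht := hhor0 1 (Or.inl rfl)
    simp only [neg_mul, one_mul] at hb ht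
    have := ((hb.sub ht).add (hright.const_mul I)).sub (hleft.const_mul I)
    refine this.congr fun N ↦ ?_
    simp only [rectBoundaryIntegral]
  have hgoodN : ∀ N, max N₀ 2 ≤ N → ∀ ρ : ℂ, (dedekindZeta₁ K) ρ = 0 → 0 < ρ.re → ρ.re < 1 → ρ.im ≠ T N ∧ ρ.im ≠ -T N := by
    intro N hN ρ h0 h1 h2
    obtain ⟨ha, hb⟩ := hηsep N ρ h0 h1 h2
    have hη0N := hη0 N
    refine ⟨fun he ↦ ?_, fun he ↦ ?_⟩
    · rw [he, sub_self, abs_zero] at ha; linarith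
    · rw [he, neg_add_cancel, abs_zero] at hb; linarith
  have hid : ∀ᶠ N : ℕ in atTop,
      2 * π * I * (-(∑ ρ ∈ zeroFinset hdf hc (T N), (analyticOrderNatAt (dedekindZeta₁ K) (ρ : ℂ) : ℂ) * fordLaplace₀ f (s - ρ)) - m₀F + fordLaplace₀ f (s - 1)) =
        rectBoundaryIntegral (dzEFIntegrand K f s) (-(1 / 2)) (3 / 2) (-T N) (T N) := by
    filter_upwards [eventually_ge_atTop (max N₀ 2)] with N hN
    obtain ⟨hN2, hsN, -⟩ := hbig N hN
    have hTpos : 0 < T N := by linarith [abs_nonneg s.im]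
    rw [dzEF_contour_identity h.cont h.x₀_nonneg h.eq_zero hf00 s hTpos (hgoodN N hN),
      sum_rectZeros_dedekindZeta₁ hTpos _ hc, ← sum_zeroFinset_eq hdf hc (T N)]
    congr 1
    rw [hm₀F, sub_zero]
    simp only [neg_mul, Finset.sum_neg_distrib]
    ring
  have hlim2 : Tendsto (fun N : ℕ ↦
      2 * π * I * (-(∑ ρ ∈ zeroFinset hdf hc (T N), (analyticOrderNatAt (dedekindZeta₁ K) (ρ : ℂ) : ℂ) * fordLaplace₀ f (s - ρ)) - m₀F + fordLaplace₀ f (s - 1)))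
      atTop (𝓝 (2 * π * I * (-S - m₀F + fordLaplace₀ f (s - 1)))) :=
    ((hpart.neg.sub tendsto_const_nhds).add tendsto_const_nhds).const_mul _
  have heq := tendsto_nhds_unique hlim2 (hlim1.congr' (hid.mono fun N h ↦ h.symm))
  have hπ : (2 * π * I : ℂ) ≠ 0 := by simp [Real.pi_ne_zero]
  have key : 2 * π * I * (coefFordK (cgCoef (1 : ClassGroup (𝓞 K) →* ℂˣ)) f s - dzEFRemainder K f s) =
      2 * π * I * (-S - m₀F + fordLaplace₀ f (s - 1)) := by
    rw [heq]; ring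
  have := mul_left_cancel₀ hπ key
  rw [hm₀F] at this
  linear_combination this

end Literature.NumberTheory.LFunctions.NumberField

end
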